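import Summits.AnomalousDissipation.AnomalousDissipation.Theorems.SoloBlindMomentumFlux
import Literature.Analysis.FluidPDE.LerayHopfGalileanTorusEnergy
import Literature.Analysis.FluidPDE.DoeringFoiasPowerProofs

/-!
# Solo (blind) — the flux-moment identities along Leray–Hopf weak solutions

`ZerothLaw` quantifies over Leray–Hopf weak solutions, not classical ones. The time-sliced weak
formulation of a Leray–Hopf solution on the torus
(`Torus.IsLerayHopfOn.integral_inner_eq_add_setIntegral`: for every `t ∈ (0, T]` and every smooth
divergence-free `Ψ`, `⟨u(t), Ψ⟩ = ⟨u₀, Ψ⟩ + ∫_{(0,t]} ∫ (⟪u,(u·∇)Ψ⟫ + ν⟪u,ΔΨ⟫ + ⟪f,Ψ⟫)`) tested with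
the three fields `e₃`, `g = sin(2πx₃)e₁`, `f = cos(2πx₃)e₁` gives, for EVERY Leray–Hopf weak
solution of the Kolmogorov-forced system (`f = kolForce`) with datum `u₀` and every `t ∈ (0, T]`:

* `∫u₃(t) = ∫(u₀)₃` (`lh_crossMomentum_eq`);
* `S(t) = S₀ + ∫_{(0,t]} (2π B − 4π²ν S)` (`lh_sinMoment_eq`);
* `W(t) = W₀ + ∫_{(0,t]} (½ − 2π A − 4π²ν W)` (`lh_work_eq`);
* the exact time-averaged WORK FORMULA with boundary terms (`lh_work_formula`)
  `2π (m₃² + 4π²ν²) ∫_{(0,t]} W = πν t − 4π²ν ∫Φ_s − 2π m₃ ∫Φ_c − 2πν (W(t) − W₀) + m₃ (S(t) − S₀)`,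

with `W(s) = ∫⟪f, u(s)⟫` (injected power), `S(s) = ∫⟪g, u(s)⟫`, `A = ∫u₃⟪g,u⟫`, `B = ∫u₃⟪f,u⟫`,
`m₃ = ∫(u₀)₃`, `Φ_s = ∫(u₃ − m₃)⟪g,u⟫`, `Φ_c = ∫(u₃ − m₃)⟪f,u⟫`, `W₀ = ∫⟪f,u₀⟫`, `S₀ = ∫⟪g,u₀⟫`.
The slices `u(s) ∈ L²` suffice for every pairing (`Torus.integrable_inner_convect_self`). By the
Leray–Hopf energy inequality `ν ∫₀ᵗ‖∇u‖² ≤ ½‖u₀‖² + ∫₀ᵗ W`, so along any putative `ZerothLaw`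
witness family built on the Kolmogorov force the dissipation floor must be carried by the
right-hand side of the work formula: at `m₃ = 0` by an `O(ν)` defect of the universally pinned
in-phase flux `Φ_s → 1/(4π)`, at `m₃ ≠ 0` by an `O(1)` quadrature correlation `Φ_c → −m₃⟨W⟩`.
[folklore; cite: Temam1984, Ch. III §1.1 (1.22)–(1.25), Lemma 1.1 (time-sliced weak formulation);
cite: MusacchioBoffetta2014, §2 eq. (2.4) (mean momentum budget of the Kolmogorov flow)]
-/

open MeasureTheory Filter Topology Set UnitAddTorus
open scoped ENNReal NNReal ComplexConjugate InnerProductSpace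

noncomputable section

namespace Summit.AnomalousDissipation.AnomalousDissipation.Theorems

open Literature.Analysis.FunctionSpaces Literature.Analysis.FunctionSpaces.Torus
open Literature.Analysis.FluidPDE

/-! ### Bookkeeping for the steady Kolmogorov force -/

/-- The steady Kolmogorov force is space–time measurable. [folklore] -/
theorem aestronglyMeasurable_stLift_kolForce (μ : Measure (ℝ × EuclideanSpace ℝ (Fin 3))) :
    AEStronglyMeasurable (Torus.stLift (fun _ : ℝ => kolForce)) μ :=
  Literature.Analysis.FluidPDE.aestronglyMeasurable_stLift_steady isSmooth_kolForce.continuous μ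

/-- The steady Kolmogorov force has finite space–time `L²` mass on `(0,T) × 𝕋³`. [folklore] -/
theorem lintegral_kolForce_lt_top (T : ℝ) :
    ∫⁻ _ in Ioo (0 : ℝ) T, ∫⁻ x, ‖kolForce x‖ₑ ^ 2 < ⊤ :=
  Literature.Analysis.FluidPDE.lintegral_Ioo_lintegral_enorm_sq_steady_lt_top
    (isSmooth_kolForce.memLp 2) T

/-- The constant test vector `e₃` for the weak formulation. [folklore] -/
def e3Test : EuclideanSpace ℝ (Fin 3) := EuclideanSpace.single 2 1

/-- `⟪v, e₃⟫ = v₃`. [folklore] -/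
theorem inner_e3Test_right (v : EuclideanSpace ℝ (Fin 3)) : ⟪v, e3Test⟫_ℝ = v 2 := by
  rw [e3Test, EuclideanSpace.inner_single_right]
  simp

/-- Swapping the factors of an `L²` pairing. [folklore] -/
theorem integral_inner_comm' (F U : UnitAddTorus (Fin 3) → EuclideanSpace ℝ (Fin 3)) :
    ∫ x, ⟪U x, F x⟫_ℝ = ∫ x, ⟪F x, U x⟫_ℝ :=
  integral_congr_ae (ae_of_all _ fun _ => real_inner_comm _ _)

/-! ### The slice identities for `L²` fields -/

/-- The flux integrand against `g` of an `L²` slice: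
`∫ (⟪U,(U·∇)g⟫ + ν⟪U,Δg⟫ + ⟪f,g⟫) = 2π ∫U₃⟪f,U⟫ − 4π²ν ∫⟪g,U⟫`. [folklore] -/
theorem sliceFlux_kolSin {U : UnitAddTorus (Fin 3) → EuclideanSpace ℝ (Fin 3)}
    (hU : MemLp U 2 volume) (ν : ℝ) :
    ∫ x, (⟪U x, Torus.convect U kolSin x⟫_ℝ + ν * ⟪U x, Torus.laplacian kolSin x⟫_ℝ +
        ⟪kolForce x, kolSin x⟫_ℝ) =
      2 * Real.pi * (∫ x, U x 2 * ⟪kolForce x, U x⟫_ℝ) -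
        4 * Real.pi ^ 2 * ν * ∫ x, ⟪kolSin x, U x⟫_ℝ := by
  have h1 : Integrable (fun x => ⟪U x, Torus.convect U kolSin x⟫_ℝ) volume :=
    Torus.integrable_inner_convect_self hU isSmooth_kolSin
  have h2 : Integrable (fun x => ν * ⟪U x, Torus.laplacian kolSin x⟫_ℝ) volume :=
    (Torus.integrable_inner_of_continuous (hU.integrable one_le_two)
      isSmooth_kolSin.laplacian.continuous).const_mul ν
  have h3 : Integrable (fun x => ⟪kolForce x, kolSin x⟫_ℝ) volume :=
    Torus.integrable_inner_of_continuous isSmooth_kolForce.integrable isSmooth_kolSin.continuous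
  have h12 : Integrable (fun x => ⟪U x, Torus.convect U kolSin x⟫_ℝ +
      ν * ⟪U x, Torus.laplacian kolSin x⟫_ℝ) volume := h1.add h2
  rw [integral_add h12 h3, integral_add h1 h2, integral_const_mul,
    integral_inner_convect_kolSin, integral_inner_laplacian_kolSin, integral_inner_kolForce_kolSin]
  ring

/-- The flux integrand against `f` of an `L²` slice:
`∫ (⟪U,(U·∇)f⟫ + ν⟪U,Δf⟫ + ⟪f,f⟫) = ½ − 2π ∫U₃⟪g,U⟫ − 4π²ν ∫⟪f,U⟫`. [folklore] -/
theorem sliceFlux_kolForce {U : UnitAddTorus (Fin 3) → EuclideanSpace ℝ (Fin 3)}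
    (hU : MemLp U 2 volume) (ν : ℝ) :
    ∫ x, (⟪U x, Torus.convect U kolForce x⟫_ℝ + ν * ⟪U x, Torus.laplacian kolForce x⟫_ℝ +
        ⟪kolForce x, kolForce x⟫_ℝ) =
      1 / 2 - 2 * Real.pi * (∫ x, U x 2 * ⟪kolSin x, U x⟫_ℝ) -
        4 * Real.pi ^ 2 * ν * ∫ x, ⟪kolForce x, U x⟫_ℝ := by
  have h1 : Integrable (fun x => ⟪U x, Torus.convect U kolForce x⟫_ℝ) volume :=
    Torus.integrable_inner_convect_self hU isSmooth_kolForce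
  have h2 : Integrable (fun x => ν * ⟪U x, Torus.laplacian kolForce x⟫_ℝ) volume :=
    (Torus.integrable_inner_of_continuous (hU.integrable one_le_two)
      isSmooth_kolForce.laplacian.continuous).const_mul ν
  have h3 : Integrable (fun x => ⟪kolForce x, kolForce x⟫_ℝ) volume :=
    Torus.integrable_inner_of_continuous isSmooth_kolForce.integrable isSmooth_kolForce.continuous
  have h12 : Integrable (fun x => ⟪U x, Torus.convect U kolForce x⟫_ℝ +
      ν * ⟪U x, Torus.laplacian kolForce x⟫_ℝ) volume := h1.add h2
  rw [integral_add h12 h3, integral_add h1 h2, integral_const_mul,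
    integral_inner_convect_kolForce, integral_inner_laplacian_kolForce,
    integral_inner_kolForce_self]
  ring

/-- The flux moment `∫U₃⟪f,U⟫` of an `L²` slice is a genuine integral (it is `(2π)⁻¹⟪U,(U·∇)g⟫`
pointwise). [folklore] -/
theorem integrable_fluxMoment_cos {U : UnitAddTorus (Fin 3) → EuclideanSpace ℝ (Fin 3)}
    (hU : MemLp U 2 volume) : Integrable (fun x => U x 2 * ⟪kolForce x, U x⟫_ℝ) volume := by
  refine ((Torus.integrable_inner_convect_self hU isSmooth_kolSin).const_mul
    (2 * Real.pi)⁻¹).congr (ae_of_all _ fun x => ?_)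
  dsimp only
  rw [convect_kolSin, real_inner_smul_right, real_inner_comm]
  field_simp

/-- The flux moment `∫U₃⟪g,U⟫` of an `L²` slice is a genuine integral (it is `−(2π)⁻¹⟪U,(U·∇)f⟫`
pointwise). [folklore] -/
theorem integrable_fluxMoment_sin {U : UnitAddTorus (Fin 3) → EuclideanSpace ℝ (Fin 3)}
    (hU : MemLp U 2 volume) : Integrable (fun x => U x 2 * ⟪kolSin x, U x⟫_ℝ) volume := by
  refine ((Torus.integrable_inner_convect_self hU isSmooth_kolForce).const_mul
    (-(2 * Real.pi)⁻¹)).congr (ae_of_all _ fun x => ?_)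
  dsimp only
  rw [convect_kolForce, real_inner_smul_right, real_inner_comm]
  field_simp

/-- Splitting off the mean in an `L²` flux moment: `∫(U₃ − m)⟪F,U⟫ = ∫U₃⟪F,U⟫ − m ∫⟪F,U⟫`.
[folklore] -/
theorem integral_fluct_mul_L2 {U F : UnitAddTorus (Fin 3) → EuclideanSpace ℝ (Fin 3)}
    (hU : MemLp U 2 volume) (hF : IsSmooth F)
    (hi : Integrable (fun x => U x 2 * ⟪F x, U x⟫_ℝ) volume) (m : ℝ) :
    ∫ x, (U x 2 - m) * ⟪F x, U x⟫_ℝ = (∫ x, U x 2 * ⟪F x, U x⟫_ℝ) - m * ∫ x, ⟪F x, U x⟫_ℝ := by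
  have i2 : Integrable (fun x => m * ⟪F x, U x⟫_ℝ) volume :=
    ((Torus.integrable_inner_of_continuous (hU.integrable one_le_two) hF.continuous).congr
      (ae_of_all _ fun x => real_inner_comm _ _)).const_mul m
  simp_rw [sub_mul]
  rw [integral_sub hi i2, integral_const_mul]

/-! ### The identities along a Leray–Hopf weak solution -/

variable {T ν : ℝ} {u₀ : UnitAddTorus (Fin 3) → EuclideanSpace ℝ (Fin 3)}
  {u : ℝ → UnitAddTorus (Fin 3) → EuclideanSpace ℝ (Fin 3)}

/-- **Conservation of cross-layer momentum** along every Leray–Hopf weak solution of the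
Kolmogorov-forced system: `∫ u₃(t) = ∫ (u₀)₃` for `t ∈ (0, T]`.
[folklore; cite: Temam1984, Ch. III §1.1 (1.25)] -/
theorem lh_crossMomentum_eq (h : Torus.IsLerayHopfOn T ν (fun _ => kolForce) u₀ u) (hT : 0 < T)
    {t : ℝ} (ht : t ∈ Ioc 0 T) : ∫ x, u t x 2 = ∫ x, u₀ x 2 := by
  have hF : ∫ x, ⟪kolForce x, e3Test⟫_ℝ = 0 := by
    rw [← Torus.inner_integral_left_eq_integral_inner isSmooth_kolForce.integrable e3Test,
      show ∫ y, kolForce y = 0 from hasZeroMean_kolForce, inner_zero_left]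
  have key := h.integral_inner_const_eq hT (aestronglyMeasurable_stLift_kolForce _)
    (lintegral_kolForce_lt_top T) e3Test ht
  simp only [hF, integral_zero, add_zero] at key
  simp_rw [inner_e3Test_right] at key
  exact key

/-- **The quadrature identity along a Leray–Hopf weak solution**:
`∫⟪g,u(t)⟫ = ∫⟪g,u₀⟫ + ∫_{(0,t]} (2π ∫u₃⟪f,u⟫ − 4π²ν ∫⟪g,u⟫) ds`, `t ∈ (0, T]`.
[folklore; cite: Temam1984, Ch. III §1.1 (1.25)] -/
theorem lh_sinMoment_eq (h : Torus.IsLerayHopfOn T ν (fun _ => kolForce) u₀ u) (hT : 0 < T)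
    {t : ℝ} (ht : t ∈ Ioc 0 T) :
    ∫ x, ⟪kolSin x, u t x⟫_ℝ = (∫ x, ⟪kolSin x, u₀ x⟫_ℝ) + ∫ s in Ioc 0 t,
      (2 * Real.pi * (∫ x, u s x 2 * ⟪kolForce x, u s x⟫_ℝ) -
        4 * Real.pi ^ 2 * ν * ∫ x, ⟪kolSin x, u s x⟫_ℝ) := by
  have key := h.integral_inner_eq_add_setIntegral hT (aestronglyMeasurable_stLift_kolForce _)
    (lintegral_kolForce_lt_top T) isSmooth_kolSin isDivFree_kolSin ht
  rw [integral_inner_comm' kolSin (u t), integral_inner_comm' kolSin u₀] at key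
  rw [key]
  congr 1
  refine setIntegral_congr_fun measurableSet_Ioc fun s hs => ?_
  exact sliceFlux_kolSin (h.memLp s ⟨hs.1.le, hs.2.trans ht.2⟩) ν

/-- **The work identity along a Leray–Hopf weak solution**:
`∫⟪f,u(t)⟫ = ∫⟪f,u₀⟫ + ∫_{(0,t]} (½ − 2π ∫u₃⟪g,u⟫ − 4π²ν ∫⟪f,u⟫) ds`, `t ∈ (0, T]`.
[folklore; cite: Temam1984, Ch. III §1.1 (1.25)] -/
theorem lh_work_eq (h : Torus.IsLerayHopfOn T ν (fun _ => kolForce) u₀ u) (hT : 0 < T)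
    {t : ℝ} (ht : t ∈ Ioc 0 T) :
    ∫ x, ⟪kolForce x, u t x⟫_ℝ = (∫ x, ⟪kolForce x, u₀ x⟫_ℝ) + ∫ s in Ioc 0 t,
      (1 / 2 - 2 * Real.pi * (∫ x, u s x 2 * ⟪kolSin x, u s x⟫_ℝ) -
        4 * Real.pi ^ 2 * ν * ∫ x, ⟪kolForce x, u s x⟫_ℝ) := by
  have key := h.integral_inner_eq_add_setIntegral hT (aestronglyMeasurable_stLift_kolForce _)
    (lintegral_kolForce_lt_top T) isSmooth_kolForce isDivFree_kolForce ht
  rw [integral_inner_comm' kolForce (u t), integral_inner_comm' kolForce u₀] at key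
  rw [key]
  congr 1
  refine setIntegral_congr_fun measurableSet_Ioc fun s hs => ?_
  exact sliceFlux_kolForce (h.memLp s ⟨hs.1.le, hs.2.trans ht.2⟩) ν

/-! ### Time integrability of the four moments -/

/-- The pairings `s ↦ ∫⟪F, u(s)⟫` are integrable on `(0, T)`. [folklore] -/
theorem lh_integrableOn_pairing (h : Torus.IsLerayHopfOn T ν (fun _ => kolForce) u₀ u)
    {F : UnitAddTorus (Fin 3) → EuclideanSpace ℝ (Fin 3)} (hF : IsSmooth F) :
    IntegrableOn (fun s => ∫ x, ⟪F x, u s x⟫_ℝ) (Ioo 0 T) :=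
  (h.integrableOn_integral_inner hF.continuous).congr_fun
    (fun s _ => integral_inner_comm' F (u s)) measurableSet_Ioo

/-- The flux moment `s ↦ ∫u₃⟪f,u⟫` is integrable on `(0, T)`. [folklore] -/
theorem lh_integrableOn_fluxMoment_cos (h : Torus.IsLerayHopfOn T ν (fun _ => kolForce) u₀ u) :
    IntegrableOn (fun s => ∫ x, u s x 2 * ⟪kolForce x, u s x⟫_ℝ) (Ioo 0 T) := by
  have hFl := h.integrableOn_flux (aestronglyMeasurable_stLift_kolForce _)
    (lintegral_kolForce_lt_top T) isSmooth_kolSin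
  have hS := lh_integrableOn_pairing h isSmooth_kolSin
  have hsum : IntegrableOn (fun s =>
      (∫ x, (⟪u s x, Torus.convect (u s) kolSin x⟫_ℝ + ν * ⟪u s x, Torus.laplacian kolSin x⟫_ℝ +
        ⟪kolForce x, kolSin x⟫_ℝ)) +
      4 * Real.pi ^ 2 * ν * ∫ x, ⟪kolSin x, u s x⟫_ℝ) (Ioo 0 T) :=
    hFl.add (hS.const_mul (4 * Real.pi ^ 2 * ν))
  have h2 : IntegrableOn (fun s => 2 * Real.pi * ∫ x, u s x 2 * ⟪kolForce x, u s x⟫_ℝ)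
      (Ioo 0 T) := by
    refine hsum.congr_fun (fun s hs => ?_) measurableSet_Ioo
    dsimp only
    rw [sliceFlux_kolSin (h.memLp s (Ioo_subset_Icc_self hs)) ν]
    ring
  have h3 : IntegrableOn (fun s => (2 * Real.pi)⁻¹ *
      (2 * Real.pi * ∫ x, u s x 2 * ⟪kolForce x, u s x⟫_ℝ)) (Ioo 0 T) := h2.const_mul _
  refine h3.congr_fun (fun s _ => ?_) measurableSet_Ioo
  dsimp only
  rw [inv_mul_cancel_left₀ (by positivity : (2 * Real.pi) ≠ 0)]

/-- The flux moment `s ↦ ∫u₃⟪g,u⟫` is integrable on `(0, T)`. [folklore] -/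
theorem lh_integrableOn_fluxMoment_sin (h : Torus.IsLerayHopfOn T ν (fun _ => kolForce) u₀ u) :
    IntegrableOn (fun s => ∫ x, u s x 2 * ⟪kolSin x, u s x⟫_ℝ) (Ioo 0 T) := by
  have hFl := h.integrableOn_flux (aestronglyMeasurable_stLift_kolForce _)
    (lintegral_kolForce_lt_top T) isSmooth_kolForce
  have hW := lh_integrableOn_pairing h isSmooth_kolForce
  haveI : IsFiniteMeasure (volume.restrict (Ioo (0 : ℝ) T)) :=
    ⟨by rw [Measure.restrict_apply_univ]; exact measure_Ioo_lt_top⟩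
  have hc : IntegrableOn (fun _ : ℝ => (1 / 2 : ℝ)) (Ioo 0 T) := integrable_const _
  have hsum : IntegrableOn (fun s =>
      (∫ x, (⟪u s x, Torus.convect (u s) kolForce x⟫_ℝ + ν * ⟪u s x, Torus.laplacian kolForce x⟫_ℝ +
        ⟪kolForce x, kolForce x⟫_ℝ)) - 1 / 2 +
      4 * Real.pi ^ 2 * ν * ∫ x, ⟪kolForce x, u s x⟫_ℝ) (Ioo 0 T) :=
    (hFl.sub hc).add (hW.const_mul (4 * Real.pi ^ 2 * ν))
  have h2 : IntegrableOn (fun s => -(2 * Real.pi) * ∫ x, u s x 2 * ⟪kolSin x, u s x⟫_ℝ)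
      (Ioo 0 T) := by
    refine hsum.congr_fun (fun s hs => ?_) measurableSet_Ioo
    dsimp only
    rw [sliceFlux_kolForce (h.memLp s (Ioo_subset_Icc_self hs)) ν]
    ring
  have h3 : IntegrableOn (fun s => (-(2 * Real.pi))⁻¹ *
      (-(2 * Real.pi) * ∫ x, u s x 2 * ⟪kolSin x, u s x⟫_ℝ)) (Ioo 0 T) := h2.const_mul _
  refine h3.congr_fun (fun s _ => ?_) measurableSet_Ioo
  dsimp only
  rw [inv_mul_cancel_left₀ (neg_ne_zero.2 (by positivity : (2 * Real.pi) ≠ 0))]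

/-- Restriction of time integrability from `(0, T)` to `(0, t]`, `t ≤ T`. [folklore] -/
theorem integrableOn_Ioc_of_Ioo {F : ℝ → ℝ} (hF : IntegrableOn F (Ioo 0 T)) {t : ℝ}
    (ht : t ≤ T) : IntegrableOn F (Ioc 0 t) :=
  (hF.mono_set (Ioo_subset_Ioo le_rfl ht)).congr_set_ae Ioo_ae_eq_Ioc.symm

/-! ### The time-averaged work formula along a Leray–Hopf weak solution -/

/-- **Time-averaged work formula along a Leray–Hopf weak solution** (exact, with boundary
terms): for `t ∈ (0, T]`, with `m₃ = ∫(u₀)₃` (the conserved cross-layer momentum),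
`W(s) = ∫⟪f,u(s)⟫`, `S(s) = ∫⟪g,u(s)⟫`, `Φ_s = ∫(u₃ − m₃)⟪g,u⟫`, `Φ_c = ∫(u₃ − m₃)⟪f,u⟫`,
`W₀ = ∫⟪f,u₀⟫`, `S₀ = ∫⟪g,u₀⟫`:

  `2π (m₃² + 4π²ν²) ∫_{(0,t]} W = πν t − 4π²ν ∫_{(0,t]} Φ_s − 2π m₃ ∫_{(0,t]} Φ_c`
  `− 2πν (W(t) − W₀) + m₃ (S(t) − S₀)`.
[folklore] -/
theorem lh_work_formula (h : Torus.IsLerayHopfOn T ν (fun _ => kolForce) u₀ u) (hT : 0 < T)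
    {t : ℝ} (ht : t ∈ Ioc 0 T) :
    2 * Real.pi * ((∫ x, u₀ x 2) ^ 2 + 4 * Real.pi ^ 2 * ν ^ 2) *
        (∫ s in Ioc 0 t, ∫ x, ⟪kolForce x, u s x⟫_ℝ) =
      Real.pi * ν * t
        - 4 * Real.pi ^ 2 * ν *
            (∫ s in Ioc 0 t, ∫ x, (u s x 2 - ∫ y, u₀ y 2) * ⟪kolSin x, u s x⟫_ℝ)
        - 2 * Real.pi * (∫ x, u₀ x 2) *
            (∫ s in Ioc 0 t, ∫ x, (u s x 2 - ∫ y, u₀ y 2) * ⟪kolForce x, u s x⟫_ℝ)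
        - 2 * Real.pi * ν * ((∫ x, ⟪kolForce x, u t x⟫_ℝ) - ∫ x, ⟪kolForce x, u₀ x⟫_ℝ)
        + (∫ x, u₀ x 2) * ((∫ x, ⟪kolSin x, u t x⟫_ℝ) - ∫ x, ⟪kolSin x, u₀ x⟫_ℝ) := by
  set m : ℝ := ∫ x, u₀ x 2 with hm
  have hA := integrableOn_Ioc_of_Ioo (lh_integrableOn_fluxMoment_sin h) ht.2
  have hB := integrableOn_Ioc_of_Ioo (lh_integrableOn_fluxMoment_cos h) ht.2
  have hS := integrableOn_Ioc_of_Ioo (lh_integrableOn_pairing h isSmooth_kolSin) ht.2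
  have hW := integrableOn_Ioc_of_Ioo (lh_integrableOn_pairing h isSmooth_kolForce) ht.2
  -- split the fluctuation moments slice by slice on `(0, t]`
  have hs : ∫ s in Ioc 0 t, ∫ x, (u s x 2 - m) * ⟪kolSin x, u s x⟫_ℝ =
      (∫ s in Ioc 0 t, ∫ x, u s x 2 * ⟪kolSin x, u s x⟫_ℝ) -
        m * ∫ s in Ioc 0 t, ∫ x, ⟪kolSin x, u s x⟫_ℝ := by
    rw [← integral_const_mul, ← integral_sub hA (hS.const_mul m)]
    refine setIntegral_congr_fun measurableSet_Ioc fun s hs' => ?_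
    have hus : MemLp (u s) 2 volume := h.memLp s ⟨hs'.1.le, hs'.2.trans ht.2⟩
    exact integral_fluct_mul_L2 hus isSmooth_kolSin (integrable_fluxMoment_sin hus) m
  have hc : ∫ s in Ioc 0 t, ∫ x, (u s x 2 - m) * ⟪kolForce x, u s x⟫_ℝ =
      (∫ s in Ioc 0 t, ∫ x, u s x 2 * ⟪kolForce x, u s x⟫_ℝ) -
        m * ∫ s in Ioc 0 t, ∫ x, ⟪kolForce x, u s x⟫_ℝ := by
    rw [← integral_const_mul, ← integral_sub hB (hW.const_mul m)]
    refine setIntegral_congr_fun measurableSet_Ioc fun s hs' => ?_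
    have hus : MemLp (u s) 2 volume := h.memLp s ⟨hs'.1.le, hs'.2.trans ht.2⟩
    exact integral_fluct_mul_L2 hus isSmooth_kolForce (integrable_fluxMoment_cos hus) m
  -- the two integrated identities, with their time integrals split
  have hI := lh_sinMoment_eq h hT ht
  have hII := lh_work_eq h hT ht
  haveI : IsFiniteMeasure (volume.restrict (Ioc (0 : ℝ) t)) :=
    ⟨by rw [Measure.restrict_apply_univ]; exact measure_Ioc_lt_top⟩
  have hhalf : IntegrableOn (fun _ : ℝ => (1 / 2 : ℝ)) (Ioc 0 t) := integrable_const _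
  rw [integral_sub (hB.const_mul _) (hS.const_mul _), integral_const_mul, integral_const_mul]
    at hI
  have i1 : IntegrableOn (fun s => 1 / 2 -
      2 * Real.pi * ∫ x, u s x 2 * ⟪kolSin x, u s x⟫_ℝ) (Ioc 0 t) := hhalf.sub (hA.const_mul _)
  rw [integral_sub i1 (hW.const_mul _),
    integral_sub hhalf (hA.const_mul _), integral_const_mul, integral_const_mul,
    setIntegral_const, Real.volume_real_Ioc_of_le ht.1.le, sub_zero, smul_eq_mul] at hII
  rw [hs, hc]
  linear_combination (2 * Real.pi * ν) * hII + (-m) * hI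

/-! ### Pinning of the in-phase flux moment along a Leray–Hopf weak solution -/

/-- Cauchy–Schwarz for the work of the Kolmogorov force on an `L²` slice:
`|∫⟪f, U⟫| ≤ √(1/2) √(∫‖U‖²)`. [folklore] -/
theorem abs_work_le_L2 {U : UnitAddTorus (Fin 3) → EuclideanSpace ℝ (Fin 3)}
    (hU : MemLp U 2 volume) :
    |∫ x, ⟪kolForce x, U x⟫_ℝ| ≤ Real.sqrt (1 / 2) * Real.sqrt (∫ x, ‖U x‖ ^ 2) := by
  have hE : Integrable (fun x => ‖kolForce x‖ ^ 2) volume :=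
    (isSmooth_kolForce.memLp 2).integrable_norm_pow two_ne_zero
  have hL : Integrable (fun x => ‖U x‖ ^ 2) volume := hU.integrable_norm_pow two_ne_zero
  have hi : Integrable (fun x => ⟪kolForce x, U x⟫_ℝ) volume :=
    (Torus.integrable_inner_of_continuous (hU.integrable one_le_two)
      isSmooth_kolForce.continuous).congr (ae_of_all _ fun x => real_inner_comm _ _)
  have hG : AEStronglyMeasurable (fun x => |⟪kolForce x, U x⟫_ℝ|) volume :=
    hi.abs.aestronglyMeasurable
  rw [← integral_norm_sq_kolForce, ← Real.sqrt_mul (integral_nonneg fun x => sq_nonneg _)]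
  refine abs_integral_le_integral_abs.trans
    (integral_le_sqrt_integral_mul_integral (ae_of_all _ fun x => abs_nonneg _)
      (ae_of_all _ fun x => sq_nonneg _) (ae_of_all _ fun x => sq_nonneg _)
      (ae_of_all _ fun x => ?_) hG hE hL)
  dsimp only
  rw [← mul_pow]
  exact pow_le_pow_left₀ (abs_nonneg _) (abs_real_inner_le_norm _ _) 2

/-- **Pinning inequality along a Leray–Hopf weak solution.** If the datum and the slices have
energy at most `R` (`∫‖u₀‖² ≤ R`, `∫‖u(s)‖² ≤ R` on `(0, T]`), then for every `t ∈ (0, T]`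
`|2π ∫_{(0,t]} ∫u₃⟪g,u⟫ − t/2| ≤ 4π²ν t √(1/2)√R + 2 √(1/2)√R`: the time mean of the in-phase
flux moment `∫ u₁u₃ sin(2πx₃)` of EVERY bounded-energy Leray–Hopf solution of the
Kolmogorov-forced system is `1/(4π) + O(ν√R) + O(√R/t)`, at any viscosity and any momentum.
[folklore; cite: Temam1984, Ch. III §1.1 (1.25)] -/
theorem lh_abs_inphase_sub_le (h : Torus.IsLerayHopfOn T ν (fun _ => kolForce) u₀ u)
    (hT : 0 < T) (hν : 0 ≤ ν) (hu₀ : MemLp u₀ 2 volume) {R : ℝ} (hR₀ : ∫ x, ‖u₀ x‖ ^ 2 ≤ R)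
    (hR : ∀ s ∈ Ioc 0 T, ∫ x, ‖u s x‖ ^ 2 ≤ R) {t : ℝ} (ht : t ∈ Ioc 0 T) :
    |2 * Real.pi * (∫ s in Ioc 0 t, ∫ x, u s x 2 * ⟪kolSin x, u s x⟫_ℝ) - t / 2| ≤
      4 * Real.pi ^ 2 * ν * t * (Real.sqrt (1 / 2) * Real.sqrt R) +
        2 * (Real.sqrt (1 / 2) * Real.sqrt R) := by
  have hA := integrableOn_Ioc_of_Ioo (lh_integrableOn_fluxMoment_sin h) ht.2
  have hW := integrableOn_Ioc_of_Ioo (lh_integrableOn_pairing h isSmooth_kolForce) ht.2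
  have hII := lh_work_eq h hT ht
  haveI : IsFiniteMeasure (volume.restrict (Ioc (0 : ℝ) t)) :=
    ⟨by rw [Measure.restrict_apply_univ]; exact measure_Ioc_lt_top⟩
  have hhalf : IntegrableOn (fun _ : ℝ => (1 / 2 : ℝ)) (Ioc 0 t) := integrable_const _
  have i1 : IntegrableOn (fun s => 1 / 2 -
      2 * Real.pi * ∫ x, u s x 2 * ⟪kolSin x, u s x⟫_ℝ) (Ioc 0 t) := hhalf.sub (hA.const_mul _)
  rw [integral_sub i1 (hW.const_mul _), integral_sub hhalf (hA.const_mul _), integral_const_mul,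
    integral_const_mul, setIntegral_const, Real.volume_real_Ioc_of_le ht.1.le, sub_zero,
    smul_eq_mul] at hII
  set M : ℝ := Real.sqrt (1 / 2) * Real.sqrt R with hM
  have hM0 : 0 ≤ M := by positivity
  have hWs : ∀ s ∈ Ioc 0 t, |∫ x, ⟪kolForce x, u s x⟫_ℝ| ≤ M := fun s hs =>
    (abs_work_le_L2 (h.memLp s ⟨hs.1.le, hs.2.trans ht.2⟩)).trans
      (mul_le_mul_of_nonneg_left (Real.sqrt_le_sqrt (hR s ⟨hs.1, hs.2.trans ht.2⟩))
        (Real.sqrt_nonneg _))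
  have hWt : |∫ x, ⟪kolForce x, u t x⟫_ℝ| ≤ M := hWs t ⟨ht.1, le_rfl⟩
  have hW0 : |∫ x, ⟪kolForce x, u₀ x⟫_ℝ| ≤ M :=
    (abs_work_le_L2 hu₀).trans
      (mul_le_mul_of_nonneg_left (Real.sqrt_le_sqrt hR₀) (Real.sqrt_nonneg _))
  have hIW : |∫ s in Ioc 0 t, ∫ x, ⟪kolForce x, u s x⟫_ℝ| ≤ M * t := by
    have hI := norm_setIntegral_le_of_norm_le_const (μ := (volume : Measure ℝ))
      (f := fun s => ∫ x, ⟪kolForce x, u s x⟫_ℝ) (measure_Ioc_lt_top (a := (0 : ℝ)) (b := t))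
      fun s hs => by rw [Real.norm_eq_abs]; exact hWs s hs
    rwa [Real.norm_eq_abs, Real.volume_real_Ioc_of_le ht.1.le, sub_zero] at hI
  have hkey : 2 * Real.pi * (∫ s in Ioc 0 t, ∫ x, u s x 2 * ⟪kolSin x, u s x⟫_ℝ) - t / 2 =
      -(4 * Real.pi ^ 2 * ν * ∫ s in Ioc 0 t, ∫ x, ⟪kolForce x, u s x⟫_ℝ) -
        ((∫ x, ⟪kolForce x, u t x⟫_ℝ) - ∫ x, ⟪kolForce x, u₀ x⟫_ℝ) := by
    linarith
  have hπ : 0 ≤ 4 * Real.pi ^ 2 * ν := by positivity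
  have hcI : |4 * Real.pi ^ 2 * ν * ∫ s in Ioc 0 t, ∫ x, ⟪kolForce x, u s x⟫_ℝ| ≤
      4 * Real.pi ^ 2 * ν * (M * t) := by
    rw [abs_mul, abs_of_nonneg hπ]
    exact mul_le_mul_of_nonneg_left hIW hπ
  obtain ⟨h1, h2⟩ := abs_le.1 hcI
  obtain ⟨h3, h4⟩ := abs_le.1 hWt
  obtain ⟨h5, h6⟩ := abs_le.1 hW0
  rw [hkey, abs_le]
  constructor <;> linarith

end Summit.AnomalousDissipation.AnomalousDissipation.Theorems
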